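import Summits.HodgeConjecture.HodgeConjecture.Theorems.F0P3XiPacketFamilyOfRecordSCD
import HarnessLib

/-!
# The record՚s Keys member `πⁿ(ξ_v)` is ADMISSIBLE at EVERY finite place (record fact for the TUPLE junction)

Cell `hodgecm-mathlib`, F0∕P3 «U3-mult», crux H413 (`stmt-HodgeConjecture-24833`); pen F0P3-p04 (g11), closer edition «K9STF ⟸ TUPLE» (desk F0P3-plan D33∕D35, BOARD rev. 7
R7-4 «record facts `hsph`∕`hadmn` ← the pen՚s ★ names»).  PROBE v7 (F0P3a-p01 (g14), c800d40d9029172b) :212 carries the (b)-row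
`hadmn : ∀ ξ v, (Pk′ ξ v).πn.IsAdmissible := sorry` — consumed UNGUARDED by ★ `SpectralPacketH.evpHψ_rhoXiS_eq_of_not_mem` ∕ `….evpGψ_eq_of_not_mem` (its `hadm` binder
ranges over all places).  ★ `F0P3XiPacketFamilyOfRecordSCD` proves admissibility only at GOOD places (`isAdmissible_isSpherical_πn_of_goodSCD`, bundled with sphericity);
this file proves it at ALL places from the two ★ cases of the record: at a split `v` the member is `i_G(ξ_w)` (★ `F0P3XiUnramSplitInstance.isAdmissible_cmSplitPacket_πn`,
unconditional), at a non-split `v` it is `πⁿ ∘ e` with `πⁿ` a Keys label — a constituent of an admissible principal series (★ `isAdmissible_of_keysLabels`) — and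
admissibility is transported along the form congruence `e` (★ `IrrClass.IsAdmissible.comap`).  PROOF LANE, 0 defs, no `sorry`.
HONEST LABEL: HC_CM is proved only modulo the 2 remaining named inputs (hLiu418, h413) until rung 0 closes; this file discharges no letter.
[Rogawski1990 §12.2 (2) pp. 173–174 (the constituents of `i_G(χ)` are admissible); §13.1 p. 199] [BernsteinZelevinsky1976 §2]
-/

set_option autoImplicit false
set_option linter.dupNamespace false

noncomputable section

open NumberField IsDedekindDomain MeasureTheory
open scoped Matrix MatrixGroups

namespace Summit.HodgeConjecture.HodgeConjecture.Cruxes.H413.F0P3XiPacketFamilyOfRecordSCD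

open Literature.NumberTheory Literature.NumberTheory.Automorphic Literature.NumberTheory.Automorphic.UnitaryGroup
open Literature.NumberTheory.Rogawski1990 Literature.NumberTheory.GaloisRepresentations
open F0P3XiLocalFamilyOfRecord F0P3XiPacketFamilyOfRecord

variable (L : Type) [Field L] [NumberField L] [IsCMField L] (H : Matrix (Fin 3) (Fin 3) L)
  (hH : (H.map (cmConjRingHom L))ᵀ = H) (hHd : IsUnit H.det) (μω : HeckeCharacter L) (hμu : μω.IsUnitary)
  [∀ v : HeightOneSpectrum (𝓞 ↥(maximalRealSubfield L)), MeasurableSpace (Gqs L v ⧸ Subgroup.center (Gqs L v))]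
  (μZ : ∀ v : HeightOneSpectrum (𝓞 ↥(maximalRealSubfield L)), Measure (Gqs L v ⧸ Subgroup.center (Gqs L v)))
  (keys : ∀ (ξ : OneDimAutRepH L) (v : HeightOneSpectrum (𝓞 ↥(maximalRealSubfield L))),
    (∀ w : PlacesOver L v, IsCMField.complexConj L • w.1 = w.1) →
      {p : IrrClass (Gqs L v) × IrrClass (Gqs L v) //
        KeysCaseTwoLabels L v (μω.semilocalComponent L v) (torusLocalComponent L (IsCMField.complexConj L) v ξ.η)
          (torusLocalComponent L (IsCMField.complexConj L) v ξ.ψ) p.1 p.2 ∧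
        p.1.IsSquareIntegrable (μZ v) ∧ ¬ p.2.IsSquareIntegrable (μZ v)})
  (hSC : ∀ (ξ : OneDimAutRepH L) (v : HeightOneSpectrum (𝓞 ↥(maximalRealSubfield L)))
    (hns : ∀ w : PlacesOver L v, IsCMField.complexConj L • w.1 = w.1)
    (T : GL (Fin 3) (LocalRing L v)) (a : LocalRing L v) (ha : IsUnit a)
    (h : formCongr (conjLocal L (IsCMField.complexConj L) v) T (H.map (algebraMap L (LocalRing L v))) =
      a • (Matrix.of fun i j : Fin 3 => if i.val + j.val + 1 = 3 then (1 : L) else 0).map (algebraMap L (LocalRing L v)))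
    (π2 πn : IrrClass (Gqs L v)),
    KeysCaseTwoLabels L v (μω.semilocalComponent L v) (torusLocalComponent L (IsCMField.complexConj L) v ξ.η)
      (torusLocalComponent L (IsCMField.complexConj L) v ξ.ψ) π2 πn → ¬ πn.IsSquareIntegrable (μZ v) →
    {πs : IrrClass ((cmDatum L 3 H).Local v) // πs.IsSupercuspidal ∧ πs ≠ IrrClass.comap (cmDatumLocalCongr L v T ha h).symm πn})

/-- **The record՚s member `πⁿ(ξ_v)` is admissible at EVERY finite place `v`** (split: `i_G(ξ_w)`; non-split: the Keys label `πⁿ`, a constituent of the admissible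
principal series `i_G(χ_{ξ,v})`, transported along the form congruence of record).  The TUPLE junction՚s row `hadmn`.
[cite: Rogawski1990, §12.2 (2) pp. 173–174; §13.1 p. 199] -/
theorem isAdmissible_πn_xiPacketFamilyOfRecordSCD (ξ : OneDimAutRepH L) (v : HeightOneSpectrum (𝓞 ↥(maximalRealSubfield L))) :
    (xiPacketFamilyOfRecordSCD L H hH hHd μω hμu μZ keys hSC ξ v).πn.IsAdmissible := by
  rcases Classical.em (∃ w : PlacesOver L v, IsCMField.complexConj L • w.1 ≠ w.1) with hs | hs
  · rw [xiPacketFamilyOfRecordSCD_of_split L H hH hHd μω hμu μZ keys hSC ξ v hs]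
    exact F0P3XiUnramSplitInstance.isAdmissible_cmSplitPacket_πn L H hH hHd v _ _ _ _ _ _ _ _
  · have hns : ∀ w : PlacesOver L v, IsCMField.complexConj L • w.1 = w.1 := fun w => not_not.1 fun hw => hs ⟨w, hw⟩
    obtain ⟨T, a, ha, h, hP, -⟩ := xiPacketFamilyOfRecordSCD_of_nonsplit L H hH hHd μω hμu μZ keys hSC ξ v hns
    rw [hP]
    exact (isAdmissible_of_keysLabels L μω ξ v (keys ξ v hns).2.1).comap _

end Summit.HodgeConjecture.HodgeConjecture.Cruxes.H413.F0P3XiPacketFamilyOfRecordSCD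

end
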